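import Literature.Computability.AlgebraicComplexity.LaserMethodTypes
import HarnessLib

/-!
# More asymmetric hashing: retained families in which only the `X`-blocks are unique
(Alman–Duan–Vassilevska Williams–Xu–Xu–Zhou 2025, Lemma 5.5; Vassilevska Williams–Xu–Xu–Zhou 2024,
Claims 5.6–5.7) — proved

Topic `Literature/Computability/AlgebraicComplexity`.  The hashing step of the laser method in the
"more asymmetric" form of Alman–Duan–Vassilevska Williams–Xu–Xu–Zhou, *More asymmetry yields
faster matrix multiplication* (SODA 2025, arXiv:2404.16349), §5.2 "More Asymmetric Hashing".
With the Coppersmith–Winograd hash functions `h_X, h_Y, h_Z : {0,…,2^ℓ}^n → ℤ_M` (seeds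
`b₀, w₀, …, w_n`), a Salem–Spencer set `B ⊆ ℤ_M`, all blocks with hash value outside `B` zeroed out
— so that every remaining block triple `X_I Y_J Z_K` has `h_X(I) = h_Y(J) = h_Z(K) ∈ B` — and then
**only** the `X`-blocks `X_I` lying in two remaining triples hashed to the same `b` zeroed out
("`𝒯_hash`"; "every level-`ℓ` `X`-block is in a unique level-`ℓ` block triple in `𝒯_hash`.  We highlight
the fact that this is the start of the main deviation from previous works": in Duan–Wu–Zhou 2023 and
Vassilevska Williams–Xu–Xu–Zhou 2024 the `X`- AND `Y`-blocks are made unique, in all earlier works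
all three), the paper states:

> **Lemma 5.5 (Properties of more asymmetric hashing).** (1) For any level-`ℓ` block triple
> `X_I Y_J Z_K ∈ 𝒯` and every bucket `b ∈ ℤ_M`, `Pr[h_X(I) = h_Y(J) = h_Z(K) = b] = 1/M²`; for any two
> different block triples `X_I Y_J Z_K, X_I Y_{J'} Z_{K'} ∈ 𝒯` sharing the same `X`-block,
> `Pr[h_X(I) = h_Y(J') = h_Z(K') = b | h_X(I) = h_Y(J) = h_Z(K) = b] = 1/M`, and the same for blocks
> sharing a `Y`- or `Z`-block.  (2) For every `b ∈ B` and every triple `X_I Y_J Z_K ∈ 𝒯` consistent with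
> `α`, `Pr[X_I Y_J Z_K ∈ 𝒯_hash | h_X(I) = h_Y(J) = h_Z(K) = b] ≥ 3/4`.  (3)
> `E[number of level-ℓ triples in 𝒯_hash] ≥ 𝒩_α · M₀^{-1-o(1)}`.

(`𝒯` = the block triples of the prescribed marginal types, `𝒩_α` = the number of those of joint type
`α`, `M ∈ [M₀, 2M₀]` prime, `M₀ ≥ 8 ·` (number of triples per block).)

## What is proved

Everything is purely combinatorial and in the coordinates of `LaserHashing.lean` /
`LaserMethodTypes.lean` (the hash family `A_w(i) = α(i)·w + u₁ − u₂`, `B_w(j) = β(j)·w + u₂ − u₃`,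
`C_w(l) = γ(l)·w + u₃ − u₁` of Bürgisser–Clausen–Shokrollahi Thm. 15.39 over the seed space
`(ℤ/M)^{r+3}`, of which the paper's `(h_X, h_Y, −2 h_Z)` on the tight supports of the
Coppersmith–Winograd powers is the instance `α(I) = I`, `β(J) = J`, `γ(K) = K − 2^ℓ`,
`u₁ − u₂ = b₀`, `u₂ − u₃ = b₀ + w₀`; item (1) of the lemma — pair-uniformity and triple-independence —
is `card_seeds_pair` / `card_seeds_triple` of `LaserHashing.lean` for this family and, in the paper's
own coordinates, `AsymmetricHashing.lean` (VXXZ 2024, Claim 5.5); the buckets are an arbitrary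
zero-sum diagonal `D ⊆ D₁ × D₂ × D₃ ⊆ (ℤ/M)³`, e.g. the Salem–Spencer one `exists_zeroSum_diagonal`,
`D₃ = −2B`).  Items (2)–(3) are an expectation computation; we prove their OUTCOME by the
probabilistic method, as a deterministic existence statement about ZERO-OUTS (sets of retained blocks
`X', Y', Z'`, the retained triples being ALL the triples of `Φ` inside `X' × Y' × Z'` — not a
diagonal):

* `exists_seed_of_counts_rel`, `card_le_card_relIsolated_add_card_relCollisions` — the averaging step
  and the isolated-vertex count of `LaserHashing.lean` with the collisions that are charged restricted
  to an arbitrary relation `rel` (sharing an `X`-block; sharing an `X`- or a `Y`-block; …).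
* `exists_hashRetained_relIsolated` — the common core: for `Φ ⊆ I × J × L` `b`-tight, a sub-family
  `Φ* ⊆ Φ` (the triples "consistent with `α`"), a collision relation `rel` implying a shared block and
  charging at most `g` triples of `Φ` to a triple of `Φ*`, a prime `M > 2b` and a zero-sum diagonal
  `D`, some seed retains block sets `X₀, Y₀, Z₀` such that the triples of `Φ*` in `X₀ × Y₀ × Z₀` that are
  `rel`-isolated among the retained triples of `Φ` number `≥ |Φ*| · |D| · (M − g) / M³`.
* `advxxz2025_lemma55` — **Lemma 5.5, outcome of (2)–(3), `X`-unique form**: with `f` a bound on the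
  `X`-fibres of `Φ` there are `X' ⊆ I`, `Y' ⊆ J`, `Z' ⊆ L` such that every `X`-block of `X'` lies in AT
  MOST ONE triple of `Φ ∩ (X' × Y' × Z')`, all these retained triples belong to `Φ*` (the `X`-blocks
  of the other retained triples zeroed out too, as in VXXZ §5.2: "we check whether the unique triple
  containing it is consistent with the distribution `α`; if not, we zero out `X_I`"), and
  `M³ · |Φ* ∩ (X' × Y' × Z')| ≥ |Φ*| · |D| · (M − f)` (the paper: `≥ (3/4) · 𝒩_α |B| / M²` for
  `M ≥ 8 f`; here `(M - f)/M ≥ 3/4` as soon as `M ≥ 4f`, only the `X`-collisions being charged).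
* `advxxz2025_lemma55_typed` — the same inside the typed support `Φ = (I_μ × J_ν × L_π) ∩ S^N` of a
  tight `S` (`LaserMethodTypes.lean`), with a Bertrand prime `6f' < M ≤ 12 f'`, `f' = max(f, b)`,
  `f = |Φ| / |I_μ|` THE `X`-fibre, and the Salem–Spencer diagonal:
  `|Φ*| · rothNumberNat(3f') ≤ 173 f'² · |Φ* ∩ (X' × Y' × Z')|`, i.e. `≥ 𝒩_α · M₀^{-1-o(1)}` retained
  triples, all of type `α`, by Behrend's bound (Mathlib's `Behrend.roth_lower_bound`).
* `vxxz2024_hashing_xyUnique` — **VXXZ 2024, §5.2, Claims 5.6–5.7** (the hashing of Duan–Wu–Zhou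
  2023 / Vassilevska Williams–Xu–Xu–Zhou 2024: "each level-`ℓ` block `X_I` or `Y_J` is in a unique
  level-`ℓ` block triple … We call the tensor after this step `𝒯'`"; Claim 5.7: "The expected number of
  level-`ℓ` block triples in `𝒯'` is at least `𝒩_α · M₀^{-1-o(1)}`"): `X`- AND `Y`-blocks unique,
  retained triples in `Φ*`, `M³ · |Φ* ∩ (X' × Y' × Z')| ≥ |Φ*| · |D| · (M − f_X − f_Y)`.
  (All three unique — a free diagonal — is `BCS1997_thm1539_free_sub` of `LaserHashing.lean`.)

No definitions, no named facts.

## References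

* J. Alman, R. Duan, V. Vassilevska Williams, Y. Xu, Z. Xu, R. Zhou, *More asymmetry yields faster
  matrix multiplication*, SODA 2025, arXiv:2404.16349 (held: `paper:arxiv-2404.16349`, chunk p0016):
  §5.2 "More Asymmetric Hashing", Lemma 5.5 and the definition of `𝒯_hash`.
  [AlmanDuanVassilevskaWilliamsXuXuZhou2025]
* V. Vassilevska Williams, Y. Xu, Z. Xu, R. Zhou, *New bounds for matrix multiplication: from alpha
  to omega*, SODA 2024, arXiv:2307.07970 (held: `paper:arxiv-2307.07970`, chunk p0020): §5.2
  "Asymmetric Hashing", Claims 5.5–5.7 and the definition of `𝒯'`. [VassilevskaWilliamsXuXuZhou2024]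
* R. Duan, H. Wu, R. Zhou, *Faster matrix multiplication via asymmetric hashing*, FOCS 2023,
  arXiv:2210.10173 (the origin of asymmetric hashing, as recalled in ADVXXZ §5.2).
* P. Bürgisser, M. Clausen, M. A. Shokrollahi, *Algebraic Complexity Theory*, Springer 1997,
  Thm. 15.39 (the hash family and the expectation computation). [BurgisserClausenShokrollahi1997]
-/

open scoped BigOperators
open Finset

namespace Literature.Computability.AlgebraicComplexity

/-! ## Isolated elements and the averaging step for a general collision relation -/

section Averaging

variable {I J L : Type*} [DecidableEq I] [DecidableEq J] [DecidableEq L]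

omit [DecidableEq I] [DecidableEq J] [DecidableEq L] in
/-- Isolated-vertex count for a collision relation `rel`: the elements `φ` of `Ψ*` that are
`rel`-related to no other element of `Ψ` (`¬ rel φ ψ` for `ψ ∈ Ψ ∖ {φ}`) number at least `|Ψ*|` minus
the number of ordered pairs `(φ, ψ) ∈ Ψ* × Ψ`, `φ ≠ ψ`, `rel φ ψ` (the count behind "we zero out `X_I`"
for the `X`-blocks shared by two retained triples).
[cite: AlmanDuanVassilevskaWilliamsXuXuZhou2025, Lemma 5.5 (proof of (2))] -/
theorem card_le_card_relIsolated_add_card_relCollisions [DecidableEq (I × J × L)]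
    (Ψs Ψ : Finset (I × J × L))
    (rel : I × J × L → I × J × L → Prop) [∀ φ ψ, Decidable (rel φ ψ)] :
    Ψs.card ≤ (Ψs.filter fun φ => ∀ ψ ∈ Ψ, ψ ≠ φ → ¬ rel φ ψ).card +
      ((Ψs ×ˢ Ψ).filter fun p => p.1 ≠ p.2 ∧ rel p.1 p.2).card := by
  rw [← Finset.card_filter_add_card_filter_not (s := Ψs)
    (p := fun φ => ∀ ψ ∈ Ψ, ψ ≠ φ → ¬ rel φ ψ)]
  refine Nat.add_le_add_left ?_ _
  have hsub : (Ψs.filter fun φ => ¬ ∀ ψ ∈ Ψ, ψ ≠ φ → ¬ rel φ ψ) ⊆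
      ((Ψs ×ˢ Ψ).filter fun p => p.1 ≠ p.2 ∧ rel p.1 p.2).image Prod.fst := by
    intro φ hφ
    rw [Finset.mem_filter] at hφ
    obtain ⟨hφΨ, hφ'⟩ := hφ
    push Not at hφ'
    obtain ⟨ψ, hψΨ, hne, hr⟩ := hφ'
    exact Finset.mem_image.2 ⟨(φ, ψ), Finset.mem_filter.2 ⟨Finset.mem_product.2 ⟨hφΨ, hψΨ⟩,
      hne.symm, hr⟩, rfl⟩
  exact (Finset.card_le_card hsub).trans Finset.card_image_le

omit [DecidableEq I] [DecidableEq J] [DecidableEq L] in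
/-- **The averaging step with a general collision relation** (the expectation computation of
Lemma 5.5 (2)–(3) / BCS Thm. 15.39, made a counting statement over a finite seed space).  Seeds `w`
range over a finite type; `good w φ` says that the triple `φ` is retained for the seed `w`.  If every
triple of `Φ*` is retained for at least `n_D · N₁` seeds, a triple of `Φ*` and a distinct `rel`-colliding
triple of `Φ` are retained together for at most `n_D · N₂` seeds, and every triple of `Φ*` `rel`-collides
with at most `g` triples of `Φ`, then for some seed the number of retained triples of `Φ*` minus the
number of ordered `rel`-colliding retained pairs in `Φ* × Φ` is at least `|Φ*| · n_D · (N₁ − g N₂) / #seeds`.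
[cite: AlmanDuanVassilevskaWilliamsXuXuZhou2025, Lemma 5.5 (proof of (2)–(3))] -/
theorem exists_seed_of_counts_rel [DecidableEq (I × J × L)] {W : Type*} [Fintype W] [Nonempty W]
    (Φs Φ : Finset (I × J × L))
    (good : W → I × J × L → Prop) [∀ w φ, Decidable (good w φ)]
    (rel : I × J × L → I × J × L → Prop) [∀ φ ψ, Decidable (rel φ ψ)] {nD N₁ N₂ g : ℕ}
    (h1 : ∀ φ ∈ Φs, nD * N₁ ≤ (Finset.univ.filter fun w => good w φ).card)
    (h2 : ∀ φ ∈ Φs, ∀ ψ ∈ Φ, φ ≠ ψ → rel φ ψ →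
      (Finset.univ.filter fun w => good w φ ∧ good w ψ).card ≤ nD * N₂)
    (h3 : ∀ φ ∈ Φs, (Φ.filter fun ψ => φ ≠ ψ ∧ rel φ ψ).card ≤ g) :
    ∃ w : W, (Φs.card : ℤ) * nD * ((N₁ : ℤ) - g * N₂) ≤
      Fintype.card W * (((Φs.filter (good w)).card : ℤ) -
        (((Φs.filter (good w)) ×ˢ (Φ.filter (good w))).filter fun p =>
          p.1 ≠ p.2 ∧ rel p.1 p.2).card) := by
  classical
  -- (1) total number of survivals
  have hsurv : (Φs.card : ℤ) * nD * N₁ ≤ ∑ w, ((Φs.filter (good w)).card : ℤ) := by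
    have : ∑ w, ((Φs.filter (good w)).card : ℤ) =
        ∑ φ ∈ Φs, ((univ.filter fun w => good w φ).card : ℤ) := by
      simp only [Finset.card_filter, Nat.cast_sum]
      rw [Finset.sum_comm]
    rw [this]
    calc (Φs.card : ℤ) * nD * N₁ = ∑ _φ ∈ Φs, ((nD * N₁ : ℕ) : ℤ) := by
          rw [Finset.sum_const, nsmul_eq_mul]; push_cast; ring
      _ ≤ _ := Finset.sum_le_sum fun φ hφ => by exact_mod_cast h1 φ hφ
  -- (2) total number of ordered colliding surviving pairs
  have hpairs : ∑ w, ((((Φs.filter (good w)) ×ˢ (Φ.filter (good w))).filter fun p =>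
      p.1 ≠ p.2 ∧ rel p.1 p.2).card : ℤ) ≤ (Φs.card : ℤ) * g * (nD * N₂) := by
    have e1 : ∀ w, (((Φs.filter (good w)) ×ˢ (Φ.filter (good w))).filter fun p =>
        p.1 ≠ p.2 ∧ rel p.1 p.2) =
        (((Φs ×ˢ Φ).filter fun p => p.1 ≠ p.2 ∧ rel p.1 p.2).filter
          fun p => good w p.1 ∧ good w p.2) := by
      intro w
      ext p
      simp only [Finset.mem_filter, Finset.mem_product]
      tauto
    simp_rw [e1]
    have e2 : ∑ w, ((((Φs ×ˢ Φ).filter fun p => p.1 ≠ p.2 ∧ rel p.1 p.2).filter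
          fun p => good w p.1 ∧ good w p.2).card : ℤ) =
        ∑ p ∈ (Φs ×ˢ Φ).filter (fun p => p.1 ≠ p.2 ∧ rel p.1 p.2),
          ((univ.filter fun w => good w p.1 ∧ good w p.2).card : ℤ) := by
      simp only [Finset.card_filter, Nat.cast_sum]
      rw [Finset.sum_comm]
    rw [e2]
    have hcnt : ((Φs ×ˢ Φ).filter fun p => p.1 ≠ p.2 ∧ rel p.1 p.2).card ≤ Φs.card * g := by
      rw [card_filter_product_eq_sum]
      calc ∑ a ∈ Φs, (Φ.filter fun b => (a, b).1 ≠ (a, b).2 ∧ rel (a, b).1 (a, b).2).card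
          ≤ ∑ _a ∈ Φs, g := Finset.sum_le_sum fun a ha => h3 a ha
        _ = Φs.card * g := by rw [Finset.sum_const, smul_eq_mul]
    calc ∑ p ∈ (Φs ×ˢ Φ).filter (fun p => p.1 ≠ p.2 ∧ rel p.1 p.2),
          ((univ.filter fun w => good w p.1 ∧ good w p.2).card : ℤ)
        ≤ ∑ p ∈ (Φs ×ˢ Φ).filter (fun p => p.1 ≠ p.2 ∧ rel p.1 p.2), ((nD * N₂ : ℕ) : ℤ) := by
          refine Finset.sum_le_sum fun p hp => ?_
          simp only [Finset.mem_filter, Finset.mem_product] at hp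
          exact_mod_cast h2 p.1 hp.1.1 p.2 hp.1.2 hp.2.1 hp.2.2
      _ = (((Φs ×ˢ Φ).filter fun p => p.1 ≠ p.2 ∧ rel p.1 p.2).card : ℤ) * (nD * N₂) := by
          rw [Finset.sum_const, nsmul_eq_mul]; push_cast; ring
      _ ≤ (Φs.card : ℤ) * g * (nD * N₂) := by
          exact_mod_cast Nat.mul_le_mul_right _ hcnt
  -- (3) averaging
  have hsum : ∑ _w : W, (Φs.card : ℤ) * nD * ((N₁ : ℤ) - g * N₂) ≤
      ∑ w : W, (Fintype.card W : ℤ) * (((Φs.filter (good w)).card : ℤ) -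
        ((((Φs.filter (good w)) ×ˢ (Φ.filter (good w))).filter fun p =>
          p.1 ≠ p.2 ∧ rel p.1 p.2).card : ℤ)) := by
    rw [Finset.sum_const, Finset.card_univ, nsmul_eq_mul, ← Finset.mul_sum, Finset.sum_sub_distrib]
    have : (Φs.card : ℤ) * nD * ((N₁ : ℤ) - g * N₂) =
        (Φs.card : ℤ) * nD * N₁ - (Φs.card : ℤ) * g * (nD * N₂) := by ring
    rw [this]
    exact mul_le_mul_of_nonneg_left (by linarith) (by positivity)
  have hne : (Finset.univ : Finset W).Nonempty := Finset.univ_nonempty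
  obtain ⟨w, _, hw⟩ := Finset.exists_le_of_sum_le hne hsum
  exact ⟨w, hw⟩

end Averaging

/-! ## The common core: a retained family with many `rel`-isolated triples of `Φ*` -/

section Core

variable {I J L : Type*} [DecidableEq I] [DecidableEq J] [DecidableEq L]

/-- **Asymmetric hashing, common core.**  Let `Φ ⊆ I × J × L` be `b`-tight (injective
`α, β, γ : · → ℤ^r`, entries of `α, β` bounded by `b`, `α i + β j + γ l = 0` on `Φ`), `Φ* ⊆ Φ`, and
`rel` a relation between triples that implies a shared block and relates every triple of `Φ*` to at
most `g` other triples of `Φ`; let `M > 2b` be prime and `D₁, D₂, D₃ ⊆ ℤ/M` be such that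
`D = {(x,y,z) ∈ D₁ × D₂ × D₃ | x + y + z = 0}` is a diagonal.  Then for some seed of the hash family of
BCS Thm. 15.39 the retained blocks `X₀, Y₀, Z₀` (those hashing into `D₁, D₂, D₃`; listed as the blocks
of the retained triples) satisfy: the triples of `Φ*` inside `X₀ × Y₀ × Z₀` that are `rel`-isolated among
ALL the triples of `Φ` inside `X₀ × Y₀ × Z₀` number at least `|Φ*| · |D| · (M − g) / M³`
(expected number of retained triples of `Φ*`, `|Φ*| |D| / M²`, minus the expected number of their
`rel`-collisions, `≤ |Φ*| g |D| / M³`, by pair-uniformity and triple-independence of the hash values).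
[cite: AlmanDuanVassilevskaWilliamsXuXuZhou2025, Lemma 5.5] -/
theorem exists_hashRetained_relIsolated (Φ : Finset (I × J × L)) {r b : ℕ} (α : I → Fin r → ℤ)
    (β : J → Fin r → ℤ) (γ : L → Fin r → ℤ) (hα : Function.Injective α)
    (hβ : Function.Injective β) (hγ : Function.Injective γ) (hαb : ∀ i ρ, |α i ρ| ≤ b)
    (hβb : ∀ j ρ, |β j ρ| ≤ b) (htight : ∀ φ ∈ Φ, ∀ ρ, α φ.1 ρ + β φ.2.1 ρ + γ φ.2.2 ρ = 0)
    (Φs : Finset (I × J × L)) (hΦs : Φs ⊆ Φ)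
    (rel : I × J × L → I × J × L → Prop) [∀ φ ψ, Decidable (rel φ ψ)]
    (hrel : ∀ φ ψ, rel φ ψ → φ.1 = ψ.1 ∨ φ.2.1 = ψ.2.1 ∨ φ.2.2 = ψ.2.2)
    {g : ℕ} (hg : ∀ φ ∈ Φs, (Φ.filter fun ψ => φ ≠ ψ ∧ rel φ ψ).card ≤ g)
    {M : ℕ} (hM : M.Prime) (hbM : 2 * b < M) (D₁ D₂ D₃ : Finset (ZMod M))
    (hD₁ : Set.InjOn (fun d : ZMod M × ZMod M × ZMod M => d.1)
      ↑((D₁ ×ˢ D₂ ×ˢ D₃).filter fun d => d.1 + d.2.1 + d.2.2 = 0))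
    (hD₂ : Set.InjOn (fun d : ZMod M × ZMod M × ZMod M => d.2.1)
      ↑((D₁ ×ˢ D₂ ×ˢ D₃).filter fun d => d.1 + d.2.1 + d.2.2 = 0))
    (hD₃ : Set.InjOn (fun d : ZMod M × ZMod M × ZMod M => d.2.2)
      ↑((D₁ ×ˢ D₂ ×ˢ D₃).filter fun d => d.1 + d.2.1 + d.2.2 = 0)) :
    ∃ (X₀ : Finset I) (Y₀ : Finset J) (Z₀ : Finset L),
      (Φs.card : ℤ) * ((D₁ ×ˢ D₂ ×ˢ D₃).filter fun d => d.1 + d.2.1 + d.2.2 = 0).card *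
        ((M : ℤ) - g) ≤ (M : ℤ) ^ 3 *
        ((Φs.filter fun φ => (φ.1 ∈ X₀ ∧ φ.2.1 ∈ Y₀ ∧ φ.2.2 ∈ Z₀) ∧
          ∀ ψ ∈ Φ, (ψ.1 ∈ X₀ ∧ ψ.2.1 ∈ Y₀ ∧ ψ.2.2 ∈ Z₀) → ψ ≠ φ → ¬ rel φ ψ).card : ℤ) := by
  classical
  haveI : Fact M.Prime := ⟨hM⟩
  -- notation
  set D := (D₁ ×ˢ D₂ ×ˢ D₃).filter fun d => d.1 + d.2.1 + d.2.2 = 0 with hD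
  let αZ : I → Fin r → ZMod M := fun i ρ => (α i ρ : ZMod M)
  let βZ : J → Fin r → ZMod M := fun j ρ => (β j ρ : ZMod M)
  let γZ : L → Fin r → ZMod M := fun l ρ => (γ l ρ : ZMod M)
  let hA : ((Fin r → ZMod M) × ZMod M × ZMod M × ZMod M) → I → ZMod M :=
    fun w i => αZ i ⬝ᵥ w.1 + w.2.1 - w.2.2.1
  let hB : ((Fin r → ZMod M) × ZMod M × ZMod M × ZMod M) → J → ZMod M :=
    fun w j => βZ j ⬝ᵥ w.1 + w.2.2.1 - w.2.2.2
  let hC : ((Fin r → ZMod M) × ZMod M × ZMod M × ZMod M) → L → ZMod M :=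
    fun w l => γZ l ⬝ᵥ w.1 + w.2.2.2 - w.2.1
  let good : ((Fin r → ZMod M) × ZMod M × ZMod M × ZMod M) → I × J × L → Prop :=
    fun w φ => hA w φ.1 ∈ D₁ ∧ hB w φ.2.1 ∈ D₂ ∧ hC w φ.2.2 ∈ D₃
  -- tightness modulo `M`: the three hash values of a block of `Φ` sum to zero
  have hsum0 : ∀ φ ∈ Φ, ∀ w, hA w φ.1 + hB w φ.2.1 + hC w φ.2.2 = 0 := by
    intro φ hφ w
    have hvec : αZ φ.1 + βZ φ.2.1 + γZ φ.2.2 = 0 := by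
      funext ρ
      simp only [αZ, βZ, γZ, Pi.add_apply, Pi.zero_apply]
      have h := htight φ hφ ρ
      have h' : ((α φ.1 ρ + β φ.2.1 ρ + γ φ.2.2 ρ : ℤ) : ZMod M) = 0 := by rw [h, Int.cast_zero]
      push_cast at h'
      exact h'
    have : (αZ φ.1 + βZ φ.2.1 + γZ φ.2.2) ⬝ᵥ w.1 = 0 := by rw [hvec, zero_dotProduct]
    simp only [add_dotProduct] at this
    simp only [hA, hB, hC]
    linear_combination this
  -- a block of `Φ` surviving for the seed `w` determines an element of `D`
  have hgoodD : ∀ φ ∈ Φ, ∀ w, good w φ → (hA w φ.1, hB w φ.2.1, hC w φ.2.2) ∈ D := by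
    intro φ hφ w hgw
    simp only [hD, Finset.mem_filter, Finset.mem_product]
    exact ⟨⟨hgw.1, hgw.2.1, hgw.2.2⟩, hsum0 φ hφ w⟩
  -- (h1) every block of `Φ*` survives for at least `|D| · M^{r+1}` seeds
  have h1 : ∀ φ ∈ Φs, D.card * M ^ (r + 1) ≤ (Finset.univ.filter fun w => good w φ).card := by
    intro φ hφs
    have hφ : φ ∈ Φ := hΦs hφs
    have hsub : D.biUnion (fun d => Finset.univ.filter fun w =>
        hA w φ.1 = d.1 ∧ hB w φ.2.1 = d.2.1) ⊆ Finset.univ.filter fun w => good w φ := by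
      intro w hw
      simp only [Finset.mem_biUnion, Finset.mem_filter, Finset.mem_univ, true_and] at hw
      obtain ⟨d, hd, e1, e2⟩ := hw
      simp only [hD, Finset.mem_filter, Finset.mem_product] at hd
      have e3 : hC w φ.2.2 = d.2.2 := by
        have := hsum0 φ hφ w
        rw [e1, e2] at this
        linear_combination this - hd.2
      simp only [Finset.mem_filter, Finset.mem_univ, true_and, good]
      exact ⟨e1 ▸ hd.1.1, e2 ▸ hd.1.2.1, e3 ▸ hd.1.2.2⟩
    refine le_trans ?_ (Finset.card_le_card hsub)
    rw [Finset.card_biUnion]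
    · simp only [hA, hB, αZ, βZ, card_seeds_pair, Finset.sum_const, smul_eq_mul]; rfl
    · intro d hd d' hd' hne
      simp only [Function.onFun]
      rw [Finset.disjoint_filter]
      intro w _ hw hw'
      exact hne (hD₁ hd hd' (hw.1.symm.trans hw'.1))
  -- (h2) a block of `Φ*` and a distinct colliding block of `Φ` survive together for at most
  -- `|D| · M^r` seeds
  have h2 : ∀ φ ∈ Φs, ∀ ψ ∈ Φ, φ ≠ ψ → rel φ ψ →
      (Finset.univ.filter fun w => good w φ ∧ good w ψ).card ≤ D.card * M ^ r := by
    intro φ hφs ψ hψ hne hr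
    have hcoll := hrel φ ψ hr
    have hφ : φ ∈ Φ := hΦs hφs
    have htφ := htight φ hφ
    have htψ := htight ψ hψ
    -- a vector `δ'` over `ℤ/M` with a unit coordinate, vanishing on all common seeds
    obtain ⟨δ', ⟨ρ₀, hρ₀⟩, hδ'⟩ : ∃ δ' : Fin r → ZMod M, (∃ ρ₀, δ' ρ₀ ≠ 0) ∧
        ∀ w, good w φ → good w ψ → δ' ⬝ᵥ w.1 = 0 ∧
          ∃ d ∈ D, hA w φ.1 = d.1 ∧ hB w φ.2.1 = d.2.1 := by
      -- the element of `D` hit by `φ` and by `ψ` is the same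
      have hsame : ∀ w, good w φ → good w ψ →
          (hA w φ.1, hB w φ.2.1, hC w φ.2.2) = (hA w ψ.1, hB w ψ.2.1, hC w ψ.2.2) := by
        intro w hgφ hgψ
        have hdφ := hgoodD φ hφ w hgφ
        have hdψ := hgoodD ψ hψ w hgψ
        rcases hcoll with h | h | h
        · exact hD₁ hdφ hdψ (by simp [h])
        · exact hD₂ hdφ hdψ (by simp [h])
        · exact hD₃ hdφ hdψ (by simp [h])
      by_cases hij : φ.2.1 = ψ.2.1
      · -- same `j`: then `i ≠ i'`
        have hii : φ.1 ≠ ψ.1 := by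
          intro hii
          apply hne
          have hl : γ φ.2.2 = γ ψ.2.2 := by
            funext ρ; have := htφ ρ; have := htψ ρ; rw [hii, hij] at *; linarith
          exact Prod.ext hii (Prod.ext hij (hγ hl))
        obtain ⟨ρ₀, hρ₀⟩ := exists_coord_cast_sub_ne_zero (M := M) hbM (hαb φ.1) (hαb ψ.1)
          (fun h => hii (hα h))
        refine ⟨fun ρ => αZ φ.1 ρ - αZ ψ.1 ρ, ⟨ρ₀, hρ₀⟩, fun w hgφ hgψ => ?_⟩
        have hs := hsame w hgφ hgψ
        simp only [Prod.mk.injEq] at hs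
        refine ⟨?_, _, hgoodD φ hφ w hgφ, rfl, rfl⟩
        have : hA w φ.1 - hA w ψ.1 = 0 := sub_eq_zero.2 hs.1
        simp only [hA] at this
        rw [show (fun ρ => αZ φ.1 ρ - αZ ψ.1 ρ) = αZ φ.1 - αZ ψ.1 from rfl, sub_dotProduct]
        linear_combination this
      · -- different `j`
        obtain ⟨ρ₀, hρ₀⟩ := exists_coord_cast_sub_ne_zero (M := M) hbM (hβb φ.2.1) (hβb ψ.2.1)
          (fun h => hij (hβ h))
        refine ⟨fun ρ => βZ φ.2.1 ρ - βZ ψ.2.1 ρ, ⟨ρ₀, hρ₀⟩, fun w hgφ hgψ => ?_⟩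
        have hs := hsame w hgφ hgψ
        simp only [Prod.mk.injEq] at hs
        refine ⟨?_, _, hgoodD φ hφ w hgφ, rfl, rfl⟩
        have : hB w φ.2.1 - hB w ψ.2.1 = 0 := sub_eq_zero.2 hs.2.1
        simp only [hB] at this
        rw [show (fun ρ => βZ φ.2.1 ρ - βZ ψ.2.1 ρ) = βZ φ.2.1 - βZ ψ.2.1 from rfl, sub_dotProduct]
        linear_combination this
    have hsub : (Finset.univ.filter fun w => good w φ ∧ good w ψ) ⊆
        D.biUnion fun d => Finset.univ.filter fun w =>
          δ' ⬝ᵥ w.1 = 0 ∧ hA w φ.1 = d.1 ∧ hB w φ.2.1 = d.2.1 := by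
      intro w hw
      simp only [Finset.mem_filter, Finset.mem_univ, true_and] at hw
      obtain ⟨h0, d, hd, hd1, hd2⟩ := hδ' w hw.1 hw.2
      simp only [Finset.mem_biUnion, Finset.mem_filter, Finset.mem_univ, true_and]
      exact ⟨d, hd, h0, hd1, hd2⟩
    refine (Finset.card_le_card hsub).trans (Finset.card_biUnion_le.trans ?_)
    simp only [hA, hB, αZ, βZ, card_seeds_triple _ _ _ hρ₀, Finset.sum_const, smul_eq_mul]; rfl
  -- the averaging step
  obtain ⟨w, hw⟩ := exists_seed_of_counts_rel Φs Φ good rel h1 h2 hg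
  -- the surviving blocks of `Φ` and of `Φ*`
  set Ψ := Φ.filter (good w) with hΨ
  set Ψs := Φs.filter (good w) with hΨs
  refine ⟨Ψ.image fun φ => φ.1, Ψ.image fun φ => φ.2.1, Ψ.image fun φ => φ.2.2, ?_⟩
  -- being inside the retained blocks is being retained (box-closedness of the hash condition)
  have hbox : ∀ φ ∈ Φ, ((φ.1 ∈ Ψ.image fun φ => φ.1) ∧ (φ.2.1 ∈ Ψ.image fun φ => φ.2.1) ∧
      (φ.2.2 ∈ Ψ.image fun φ => φ.2.2)) ↔ good w φ := by
    intro φ hφ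
    constructor
    · rintro ⟨h₁, h₂, h₃⟩
      simp only [Finset.mem_image, hΨ, Finset.mem_filter] at h₁ h₂ h₃
      obtain ⟨ψ₁, ⟨-, hψ₁⟩, e₁⟩ := h₁
      obtain ⟨ψ₂, ⟨-, hψ₂⟩, e₂⟩ := h₂
      obtain ⟨ψ₃, ⟨-, hψ₃⟩, e₃⟩ := h₃
      exact ⟨e₁ ▸ hψ₁.1, e₂ ▸ hψ₂.2.1, e₃ ▸ hψ₃.2.2⟩
    · intro hgφ
      have hφΨ : φ ∈ Ψ := by rw [hΨ, Finset.mem_filter]; exact ⟨hφ, hgφ⟩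
      exact ⟨Finset.mem_image.2 ⟨φ, hφΨ, rfl⟩, Finset.mem_image.2 ⟨φ, hφΨ, rfl⟩,
        Finset.mem_image.2 ⟨φ, hφΨ, rfl⟩⟩
  -- the counted set contains the blocks of `Ψ*` which are `rel`-isolated in `Ψ`
  have hset : (Ψs.filter fun φ => ∀ ψ ∈ Ψ, ψ ≠ φ → ¬ rel φ ψ) ⊆
      (Φs.filter fun φ => ((φ.1 ∈ Ψ.image fun φ => φ.1) ∧ (φ.2.1 ∈ Ψ.image fun φ => φ.2.1) ∧
          (φ.2.2 ∈ Ψ.image fun φ => φ.2.2)) ∧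
        ∀ ψ ∈ Φ, ((ψ.1 ∈ Ψ.image fun φ => φ.1) ∧ (ψ.2.1 ∈ Ψ.image fun φ => φ.2.1) ∧
          (ψ.2.2 ∈ Ψ.image fun φ => φ.2.2)) → ψ ≠ φ → ¬ rel φ ψ) := by
    intro φ hφ
    rw [Finset.mem_filter] at hφ ⊢
    rw [hΨs, Finset.mem_filter] at hφ
    obtain ⟨⟨hφs, hgφ⟩, hiso⟩ := hφ
    refine ⟨hφs, (hbox φ (hΦs hφs)).2 hgφ, fun ψ hψ hψbox hne => ?_⟩
    have hψΨ : ψ ∈ Ψ := by rw [hΨ, Finset.mem_filter]; exact ⟨hψ, (hbox ψ hψ).1 hψbox⟩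
    exact hiso ψ hψΨ hne
  -- the size bound
  have hiso := card_le_card_relIsolated_add_card_relCollisions Ψs Ψ rel
  have hWcard : (Fintype.card ((Fin r → ZMod M) × ZMod M × ZMod M × ZMod M) : ℤ) =
      (M : ℤ) ^ r * (M : ℤ) ^ 3 := by
    have : Fintype.card ((Fin r → ZMod M) × ZMod M × ZMod M × ZMod M) = M ^ r * M ^ 3 := by
      simp only [Fintype.card_prod, Fintype.card_fun, ZMod.card, Fintype.card_fin]; ring
    rw [this]; push_cast; ring
  rw [hWcard] at hw
  have hMr : (0 : ℤ) < (M : ℤ) ^ r := pow_pos (by exact_mod_cast hM.pos) r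
  refine le_of_mul_le_mul_right ?_ hMr
  have hiso' : ((Ψs.card : ℤ) - (((Ψs ×ˢ Ψ).filter fun p => p.1 ≠ p.2 ∧ rel p.1 p.2).card : ℤ)) ≤
      ((Ψs.filter fun φ => ∀ ψ ∈ Ψ, ψ ≠ φ → ¬ rel φ ψ).card : ℤ) := by
    have := (Int.ofNat_le.2 hiso); push_cast at this; linarith
  have hmono : ((Ψs.filter fun φ => ∀ ψ ∈ Ψ, ψ ≠ φ → ¬ rel φ ψ).card : ℤ) ≤
      ((Φs.filter fun φ => ((φ.1 ∈ Ψ.image fun φ => φ.1) ∧ (φ.2.1 ∈ Ψ.image fun φ => φ.2.1) ∧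
          (φ.2.2 ∈ Ψ.image fun φ => φ.2.2)) ∧
        ∀ ψ ∈ Φ, ((ψ.1 ∈ Ψ.image fun φ => φ.1) ∧ (ψ.2.1 ∈ Ψ.image fun φ => φ.2.1) ∧
          (ψ.2.2 ∈ Ψ.image fun φ => φ.2.2)) → ψ ≠ φ → ¬ rel φ ψ).card : ℤ) := by
    exact_mod_cast Finset.card_le_card hset
  calc (Φs.card : ℤ) * D.card * ((M : ℤ) - g) * (M : ℤ) ^ r
      = (Φs.card : ℤ) * D.card * (((M ^ (r + 1) : ℕ) : ℤ) - g * ((M ^ r : ℕ) : ℤ)) := by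
        push_cast; ring
    _ ≤ (M : ℤ) ^ r * (M : ℤ) ^ 3 * ((Ψs.card : ℤ) - (((Ψs ×ˢ Ψ).filter fun p => p.1 ≠ p.2 ∧
        rel p.1 p.2).card : ℤ)) := hw
    _ ≤ (M : ℤ) ^ r * (M : ℤ) ^ 3 * ((Ψs.filter fun φ => ∀ ψ ∈ Ψ, ψ ≠ φ → ¬ rel φ ψ).card : ℤ) :=
        mul_le_mul_of_nonneg_left hiso' (by positivity)
    _ ≤ (M : ℤ) ^ r * (M : ℤ) ^ 3 *
        ((Φs.filter fun φ => ((φ.1 ∈ Ψ.image fun φ => φ.1) ∧ (φ.2.1 ∈ Ψ.image fun φ => φ.2.1) ∧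
          (φ.2.2 ∈ Ψ.image fun φ => φ.2.2)) ∧
        ∀ ψ ∈ Φ, ((ψ.1 ∈ Ψ.image fun φ => φ.1) ∧ (ψ.2.1 ∈ Ψ.image fun φ => φ.2.1) ∧
          (ψ.2.2 ∈ Ψ.image fun φ => φ.2.2)) → ψ ≠ φ → ¬ rel φ ψ).card : ℤ) :=
        mul_le_mul_of_nonneg_left hmono (by positivity)
    _ = (M : ℤ) ^ 3 * ((Φs.filter fun φ => ((φ.1 ∈ Ψ.image fun φ => φ.1) ∧
          (φ.2.1 ∈ Ψ.image fun φ => φ.2.1) ∧ (φ.2.2 ∈ Ψ.image fun φ => φ.2.2)) ∧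
        ∀ ψ ∈ Φ, ((ψ.1 ∈ Ψ.image fun φ => φ.1) ∧ (ψ.2.1 ∈ Ψ.image fun φ => φ.2.1) ∧
          (ψ.2.2 ∈ Ψ.image fun φ => φ.2.2)) → ψ ≠ φ → ¬ rel φ ψ).card : ℤ) * (M : ℤ) ^ r := by ring

end Core

/-! ## Lemma 5.5: the `X`-unique retained family -/

section XUnique

variable {I J L : Type*} [DecidableEq I] [DecidableEq J] [DecidableEq L]

/-- **Alman–Duan–Vassilevska Williams–Xu–Xu–Zhou 2025, Lemma 5.5 (properties of more asymmetric
hashing) — the outcome of (2)–(3), `X`-unique form.**  Let `Φ ⊆ I × J × L` be `b`-tight (injective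
`α, β, γ : · → ℤ^r`, entries of `α, β` bounded by `b`, `α i + β j + γ l = 0` on `Φ`; the block triples
`X_I Y_J Z_K`, `I_t + J_t + K_t = 2^ℓ`, of given marginal types), `Φ* ⊆ Φ` (the triples consistent with
the joint distribution `α` of the paper), every `X`-block in at most `f` triples of `Φ`, `M > 2b` prime,
and `D = {(x,y,z) ∈ D₁ × D₂ × D₃ | x+y+z = 0} ⊆ (ℤ/M)³` a diagonal (the Salem–Spencer buckets).  Then
there are sets of retained blocks `X' ⊆ I`, `Y' ⊆ J`, `Z' ⊆ L` — all blocks hashing outside the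
buckets zeroed out, then the `X`-blocks lying in two retained triples zeroed out ("`𝒯_hash`") — such
that (i) **every retained `X`-block lies in a unique retained triple**: two triples of `Φ` inside
`X' × Y' × Z'` with the same `X`-block are equal; (ii) every retained triple of `Φ` belongs to `Φ*`
(the `X`-block of a retained triple outside `Φ*` being zeroed out as well, which by (i) removes exactly
that triple — VXXZ §5.2, definition of `𝒯'`); (iii) the retained triples are many:
`M³ · |Φ* ∩ (X' × Y' × Z')| ≥ |Φ*| · |D| · (M − f)` (`= |Φ ∩ (X' × Y' × Z')|` by (ii); printed: each triple is hashed to a bucket `b`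
with probability `1/M²`, survives given that with probability `≥ 3/4` when `M ≥ 8 ·` (triples per
block), so that `E[#retained triples] ≥ 𝒩_α · M₀^{-1-o(1)}`; here by averaging over the seeds of the
hash family of BCS Thm. 15.39, `LaserHashing.lean`).
[cite: AlmanDuanVassilevskaWilliamsXuXuZhou2025, Lemma 5.5] -/
theorem advxxz2025_lemma55 (Φ : Finset (I × J × L)) {r b : ℕ} (α : I → Fin r → ℤ)
    (β : J → Fin r → ℤ) (γ : L → Fin r → ℤ) (hα : Function.Injective α)
    (hβ : Function.Injective β) (hγ : Function.Injective γ) (hαb : ∀ i ρ, |α i ρ| ≤ b)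
    (hβb : ∀ j ρ, |β j ρ| ≤ b) (htight : ∀ φ ∈ Φ, ∀ ρ, α φ.1 ρ + β φ.2.1 ρ + γ φ.2.2 ρ = 0)
    (Φs : Finset (I × J × L)) (hΦs : Φs ⊆ Φ)
    {f : ℕ} (hfI : ∀ i, (Φ.filter fun φ => φ.1 = i).card ≤ f)
    {M : ℕ} (hM : M.Prime) (hbM : 2 * b < M) (D₁ D₂ D₃ : Finset (ZMod M))
    (hD₁ : Set.InjOn (fun d : ZMod M × ZMod M × ZMod M => d.1)
      ↑((D₁ ×ˢ D₂ ×ˢ D₃).filter fun d => d.1 + d.2.1 + d.2.2 = 0))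
    (hD₂ : Set.InjOn (fun d : ZMod M × ZMod M × ZMod M => d.2.1)
      ↑((D₁ ×ˢ D₂ ×ˢ D₃).filter fun d => d.1 + d.2.1 + d.2.2 = 0))
    (hD₃ : Set.InjOn (fun d : ZMod M × ZMod M × ZMod M => d.2.2)
      ↑((D₁ ×ˢ D₂ ×ˢ D₃).filter fun d => d.1 + d.2.1 + d.2.2 = 0)) :
    ∃ (X' : Finset I) (Y' : Finset J) (Z' : Finset L),
      (∀ φ ∈ Φ, ∀ ψ ∈ Φ, (φ.1 ∈ X' ∧ φ.2.1 ∈ Y' ∧ φ.2.2 ∈ Z') →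
        (ψ.1 ∈ X' ∧ ψ.2.1 ∈ Y' ∧ ψ.2.2 ∈ Z') → φ.1 = ψ.1 → φ = ψ) ∧
      (∀ φ ∈ Φ, (φ.1 ∈ X' ∧ φ.2.1 ∈ Y' ∧ φ.2.2 ∈ Z') → φ ∈ Φs) ∧
      (Φs.card : ℤ) * ((D₁ ×ˢ D₂ ×ˢ D₃).filter fun d => d.1 + d.2.1 + d.2.2 = 0).card *
        ((M : ℤ) - f) ≤ (M : ℤ) ^ 3 *
        ((Φs.filter fun φ => φ.1 ∈ X' ∧ φ.2.1 ∈ Y' ∧ φ.2.2 ∈ Z').card : ℤ) := by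
  classical
  have hg : ∀ φ ∈ Φs, (Φ.filter fun ψ => φ ≠ ψ ∧ φ.1 = ψ.1).card ≤ f := fun φ _ =>
    (Finset.card_le_card fun ψ hψ => by
      rw [Finset.mem_filter] at hψ ⊢; exact ⟨hψ.1, hψ.2.2.symm⟩).trans (hfI φ.1)
  obtain ⟨X₀, Y₀, Z₀, hsize⟩ := exists_hashRetained_relIsolated Φ α β γ hα hβ hγ hαb hβb htight Φs
    hΦs (fun φ ψ => φ.1 = ψ.1) (fun φ ψ h => Or.inl h) hg hM hbM D₁ D₂ D₃ hD₁ hD₂ hD₃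
  -- the retained triples; keep the retained `X`-blocks lying in exactly one of them, which
  -- moreover belongs to `Φ*`
  set Ψ₀ := Φ.filter fun φ => φ.1 ∈ X₀ ∧ φ.2.1 ∈ Y₀ ∧ φ.2.2 ∈ Z₀ with hΨ₀
  refine ⟨X₀.filter fun i => (∀ φ ∈ Ψ₀, ∀ ψ ∈ Ψ₀, φ.1 = i → ψ.1 = i → φ = ψ) ∧
    ∀ φ ∈ Ψ₀, φ.1 = i → φ ∈ Φs, Y₀, Z₀, ?_, ?_, ?_⟩
  · intro φ hφ ψ hψ hφb hψb he
    have hi := (Finset.mem_filter.1 hφb.1).2.1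
    have hφ₀ : φ ∈ Ψ₀ :=
      Finset.mem_filter.2 ⟨hφ, (Finset.mem_filter.1 hφb.1).1, hφb.2.1, hφb.2.2⟩
    have hψ₀ : ψ ∈ Ψ₀ :=
      Finset.mem_filter.2 ⟨hψ, (Finset.mem_filter.1 hψb.1).1, hψb.2.1, hψb.2.2⟩
    exact hi φ hφ₀ ψ hψ₀ rfl he.symm
  · intro φ hφ hφb
    have hφ₀ : φ ∈ Ψ₀ :=
      Finset.mem_filter.2 ⟨hφ, (Finset.mem_filter.1 hφb.1).1, hφb.2.1, hφb.2.2⟩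
    exact (Finset.mem_filter.1 hφb.1).2.2 φ hφ₀ rfl
  · refine hsize.trans (mul_le_mul_of_nonneg_left ?_ (by positivity))
    have hsub : (Φs.filter fun φ => (φ.1 ∈ X₀ ∧ φ.2.1 ∈ Y₀ ∧ φ.2.2 ∈ Z₀) ∧
        ∀ ψ ∈ Φ, (ψ.1 ∈ X₀ ∧ ψ.2.1 ∈ Y₀ ∧ ψ.2.2 ∈ Z₀) → ψ ≠ φ → ¬ φ.1 = ψ.1) ⊆
        (Φs.filter fun φ => (φ.1 ∈ X₀.filter fun i =>
          (∀ φ ∈ Ψ₀, ∀ ψ ∈ Ψ₀, φ.1 = i → ψ.1 = i → φ = ψ) ∧ ∀ φ ∈ Ψ₀, φ.1 = i → φ ∈ Φs) ∧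
          φ.2.1 ∈ Y₀ ∧ φ.2.2 ∈ Z₀) := by
      intro φ hφ
      rw [Finset.mem_filter] at hφ ⊢
      obtain ⟨hφs, hbox, hiso⟩ := hφ
      have huniq : ∀ φ' ∈ Ψ₀, φ'.1 = φ.1 → φ' = φ := by
        intro φ' hφ' e'
        rw [hΨ₀, Finset.mem_filter] at hφ'
        by_contra hne
        exact hiso φ' hφ'.1 hφ'.2 hne e'.symm
      refine ⟨hφs, Finset.mem_filter.2 ⟨hbox.1, fun φ' hφ' ψ' hψ' e' e'' => ?_,
        fun φ' hφ' e' => ?_⟩, hbox.2.1, hbox.2.2⟩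
      · rw [huniq φ' hφ' e', huniq ψ' hψ' e'']
      · rw [huniq φ' hφ' e']; exact hφs
    exact_mod_cast Finset.card_le_card hsub

/-- **Vassilevska Williams–Xu–Xu–Zhou 2024, §5.2 (asymmetric hashing of Duan–Wu–Zhou 2023), outcome
of Claims 5.6–5.7** ("each level-`ℓ` block `X_I` or `Y_J` is in a unique level-`ℓ` block triple"; ADVXXZ
§5.2: "in [DWZ23, VXXZ24], after this step all level-`ℓ` `X`-blocks and `Y`-blocks are in unique block
triples"): the same with the `X`-blocks AND the `Y`-blocks lying in two retained triples zeroed out.  With `f_X, f_Y` bounds on the `X`- and `Y`-fibres of `Φ`: retained blocks `X', Y', Z'`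
such that two triples of `Φ` inside `X' × Y' × Z'` sharing the `X`-block or the `Y`-block are equal,
every retained triple of `Φ` belongs to `Φ*` ("we check whether the unique triple containing it is
consistent with the distribution `α`; if not, we zero out `X_I`.  We call the tensor after this step
`𝒯'`"), and `M³ · |Φ* ∩ (X' × Y' × Z')| ≥ |Φ*| · |D| · (M − f_X − f_Y)` (Claim 5.6: a triple of `Φ*`
hashed to the bucket `b` survives with probability `≥ 3/4` when `M₀ ≥ 8 f_X, 8 f_Y`; Claim 5.7:
`E[#triples of 𝒯'] ≥ 𝒩_α M₀^{-1-o(1)}`).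
[cite: VassilevskaWilliamsXuXuZhou2024, §5.2, Claims 5.6–5.7] -/
theorem vxxz2024_hashing_xyUnique (Φ : Finset (I × J × L)) {r b : ℕ} (α : I → Fin r → ℤ)
    (β : J → Fin r → ℤ) (γ : L → Fin r → ℤ) (hα : Function.Injective α)
    (hβ : Function.Injective β) (hγ : Function.Injective γ) (hαb : ∀ i ρ, |α i ρ| ≤ b)
    (hβb : ∀ j ρ, |β j ρ| ≤ b) (htight : ∀ φ ∈ Φ, ∀ ρ, α φ.1 ρ + β φ.2.1 ρ + γ φ.2.2 ρ = 0)
    (Φs : Finset (I × J × L)) (hΦs : Φs ⊆ Φ)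
    {fX fY : ℕ} (hfI : ∀ i, (Φ.filter fun φ => φ.1 = i).card ≤ fX)
    (hfJ : ∀ j, (Φ.filter fun φ => φ.2.1 = j).card ≤ fY)
    {M : ℕ} (hM : M.Prime) (hbM : 2 * b < M) (D₁ D₂ D₃ : Finset (ZMod M))
    (hD₁ : Set.InjOn (fun d : ZMod M × ZMod M × ZMod M => d.1)
      ↑((D₁ ×ˢ D₂ ×ˢ D₃).filter fun d => d.1 + d.2.1 + d.2.2 = 0))
    (hD₂ : Set.InjOn (fun d : ZMod M × ZMod M × ZMod M => d.2.1)
      ↑((D₁ ×ˢ D₂ ×ˢ D₃).filter fun d => d.1 + d.2.1 + d.2.2 = 0))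
    (hD₃ : Set.InjOn (fun d : ZMod M × ZMod M × ZMod M => d.2.2)
      ↑((D₁ ×ˢ D₂ ×ˢ D₃).filter fun d => d.1 + d.2.1 + d.2.2 = 0)) :
    ∃ (X' : Finset I) (Y' : Finset J) (Z' : Finset L),
      (∀ φ ∈ Φ, ∀ ψ ∈ Φ, (φ.1 ∈ X' ∧ φ.2.1 ∈ Y' ∧ φ.2.2 ∈ Z') →
        (ψ.1 ∈ X' ∧ ψ.2.1 ∈ Y' ∧ ψ.2.2 ∈ Z') → (φ.1 = ψ.1 ∨ φ.2.1 = ψ.2.1) → φ = ψ) ∧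
      (∀ φ ∈ Φ, (φ.1 ∈ X' ∧ φ.2.1 ∈ Y' ∧ φ.2.2 ∈ Z') → φ ∈ Φs) ∧
      (Φs.card : ℤ) * ((D₁ ×ˢ D₂ ×ˢ D₃).filter fun d => d.1 + d.2.1 + d.2.2 = 0).card *
        ((M : ℤ) - (fX + fY)) ≤ (M : ℤ) ^ 3 *
        ((Φs.filter fun φ => φ.1 ∈ X' ∧ φ.2.1 ∈ Y' ∧ φ.2.2 ∈ Z').card : ℤ) := by
  classical
  have hg : ∀ φ ∈ Φs, (Φ.filter fun ψ => φ ≠ ψ ∧ (φ.1 = ψ.1 ∨ φ.2.1 = ψ.2.1)).card ≤ fX + fY := by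
    intro φ _
    calc (Φ.filter fun ψ => φ ≠ ψ ∧ (φ.1 = ψ.1 ∨ φ.2.1 = ψ.2.1)).card
        ≤ ((Φ.filter fun ψ => ψ.1 = φ.1) ∪ (Φ.filter fun ψ => ψ.2.1 = φ.2.1)).card := by
          refine Finset.card_le_card fun ψ hψ => ?_
          simp only [Finset.mem_filter, Finset.mem_union] at hψ ⊢
          rcases hψ.2.2 with h | h
          · exact Or.inl ⟨hψ.1, h.symm⟩
          · exact Or.inr ⟨hψ.1, h.symm⟩
      _ ≤ (Φ.filter fun ψ => ψ.1 = φ.1).card + (Φ.filter fun ψ => ψ.2.1 = φ.2.1).card :=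
          Finset.card_union_le _ _
      _ ≤ fX + fY := add_le_add (hfI _) (hfJ _)
  obtain ⟨X₀, Y₀, Z₀, hsize⟩ := exists_hashRetained_relIsolated Φ α β γ hα hβ hγ hαb hβb htight Φs
    hΦs (fun φ ψ => φ.1 = ψ.1 ∨ φ.2.1 = ψ.2.1)
    (fun φ ψ h => h.elim Or.inl fun h' => Or.inr (Or.inl h')) hg hM hbM D₁ D₂ D₃ hD₁ hD₂ hD₃
  set Ψ₀ := Φ.filter fun φ => φ.1 ∈ X₀ ∧ φ.2.1 ∈ Y₀ ∧ φ.2.2 ∈ Z₀ with hΨ₀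
  refine ⟨X₀.filter fun i => (∀ φ ∈ Ψ₀, ∀ ψ ∈ Ψ₀, φ.1 = i → ψ.1 = i → φ = ψ) ∧
      ∀ φ ∈ Ψ₀, φ.1 = i → φ ∈ Φs,
    Y₀.filter fun j => ∀ φ ∈ Ψ₀, ∀ ψ ∈ Ψ₀, φ.2.1 = j → ψ.2.1 = j → φ = ψ, Z₀, ?_, ?_, ?_⟩
  · intro φ hφ ψ hψ hφb hψb he
    have hφ₀ : φ ∈ Ψ₀ := Finset.mem_filter.2
      ⟨hφ, (Finset.mem_filter.1 hφb.1).1, (Finset.mem_filter.1 hφb.2.1).1, hφb.2.2⟩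
    have hψ₀ : ψ ∈ Ψ₀ := Finset.mem_filter.2
      ⟨hψ, (Finset.mem_filter.1 hψb.1).1, (Finset.mem_filter.1 hψb.2.1).1, hψb.2.2⟩
    rcases he with he | he
    · exact (Finset.mem_filter.1 hφb.1).2.1 φ hφ₀ ψ hψ₀ rfl he.symm
    · exact (Finset.mem_filter.1 hφb.2.1).2 φ hφ₀ ψ hψ₀ rfl he.symm
  · intro φ hφ hφb
    have hφ₀ : φ ∈ Ψ₀ := Finset.mem_filter.2
      ⟨hφ, (Finset.mem_filter.1 hφb.1).1, (Finset.mem_filter.1 hφb.2.1).1, hφb.2.2⟩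
    exact (Finset.mem_filter.1 hφb.1).2.2 φ hφ₀ rfl
  · have hcast : ((M : ℤ) - (fX + fY)) = (M : ℤ) - ((fX + fY : ℕ) : ℤ) := by push_cast; ring
    rw [hcast]
    refine hsize.trans (mul_le_mul_of_nonneg_left ?_ (by positivity))
    have hsub : (Φs.filter fun φ => (φ.1 ∈ X₀ ∧ φ.2.1 ∈ Y₀ ∧ φ.2.2 ∈ Z₀) ∧
        ∀ ψ ∈ Φ, (ψ.1 ∈ X₀ ∧ ψ.2.1 ∈ Y₀ ∧ ψ.2.2 ∈ Z₀) → ψ ≠ φ → ¬ (φ.1 = ψ.1 ∨ φ.2.1 = ψ.2.1)) ⊆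
        (Φs.filter fun φ => (φ.1 ∈ X₀.filter fun i =>
          (∀ φ ∈ Ψ₀, ∀ ψ ∈ Ψ₀, φ.1 = i → ψ.1 = i → φ = ψ) ∧ ∀ φ ∈ Ψ₀, φ.1 = i → φ ∈ Φs) ∧
          (φ.2.1 ∈ Y₀.filter fun j => ∀ φ ∈ Ψ₀, ∀ ψ ∈ Ψ₀, φ.2.1 = j → ψ.2.1 = j → φ = ψ) ∧
          φ.2.2 ∈ Z₀) := by
      intro φ hφ
      rw [Finset.mem_filter] at hφ ⊢
      obtain ⟨hφs, hbox, hiso⟩ := hφ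
      have huniq : ∀ φ' ∈ Ψ₀, (φ.1 = φ'.1 ∨ φ.2.1 = φ'.2.1) → φ' = φ := by
        intro φ' hφ' hc
        rw [hΨ₀, Finset.mem_filter] at hφ'
        by_contra hne
        exact hiso φ' hφ'.1 hφ'.2 hne hc
      refine ⟨hφs, Finset.mem_filter.2 ⟨hbox.1, fun φ' hφ' ψ' hψ' e' e'' => ?_,
          fun φ' hφ' e' => ?_⟩,
        Finset.mem_filter.2 ⟨hbox.2.1, fun φ' hφ' ψ' hψ' e' e'' => ?_⟩, hbox.2.2⟩
      · rw [huniq φ' hφ' (Or.inl e'.symm), huniq ψ' hψ' (Or.inl e''.symm)]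
      · rw [huniq φ' hφ' (Or.inl e'.symm)]; exact hφs
      · rw [huniq φ' hφ' (Or.inr e'.symm), huniq ψ' hψ' (Or.inr e''.symm)]
    exact_mod_cast Finset.card_le_card hsub

end XUnique

/-! ## Lemma 5.5 inside the typed support, with a Bertrand prime and the Salem–Spencer buckets -/

section Typed

variable {I J L : Type*} [Fintype I] [Fintype J] [Fintype L] [DecidableEq I] [DecidableEq J]
  [DecidableEq L]

/-- **ADVXXZ Lemma 5.5 in the typed support** (the setting of §5.2: `𝒯 =` the block triples of
`(CW_q^{⊗2^{ℓ-1}})^{⊗n}` consistent with the marginals `α_X, α_Y, α_Z`, `Φ* ⊆ 𝒯` those consistent with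
`α`).  Let `S ⊆ I × J × L` be `b`-tight (injective `α, β, γ : · → ℤ^r`, `α i + β j + γ l = 0` on `S`,
entries of `α, β` bounded by `b`), `Φ = (I_μ × J_ν × L_π) ∩ S^N` the typed support of the marginal types
`μ, ν, π` (`typedSupport`, assumed non-empty) and `Φ* ⊆ Φ`.  Then, with `f = |Φ|/|I_μ|` the number of
triples per `X`-block and `f' = max(f, b)`, there are retained block sets `X', Y', Z'` in which every
retained `X`-block lies in a unique retained triple of `Φ`, all retained triples of `Φ` belong to `Φ*`,
and `|Φ*| · rothNumberNat(3 f') ≤ 173 · f'² · |Φ* ∩ (X' × Y' × Z')|` — the paper's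
`E[#triples of 𝒯_hash] ≥ 𝒩_α · M₀^{-1-o(1)}`, `M₀ ≈ 8f`, by Behrend's bound on `rothNumberNat`
(hash modulus a Bertrand prime `6f' < M ≤ 12 f'`, buckets the Salem–Spencer diagonal
`exists_zeroSum_diagonal`). [cite: AlmanDuanVassilevskaWilliamsXuXuZhou2025, Lemma 5.5] -/
theorem advxxz2025_lemma55_typed (S : Finset (I × J × L)) {r b : ℕ}
    (α : I → Fin r → ℤ) (β : J → Fin r → ℤ) (γ : L → Fin r → ℤ)
    (hα : Function.Injective α) (hβ : Function.Injective β) (hγ : Function.Injective γ)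
    (hαb : ∀ i ρ, |α i ρ| ≤ b) (hβb : ∀ j ρ, |β j ρ| ≤ b)
    (htight : ∀ s ∈ S, ∀ ρ, α s.1 ρ + β s.2.1 ρ + γ s.2.2 ρ = 0)
    (N : ℕ) (μ : I → ℕ) (ν : J → ℕ) (π : L → ℕ) (hne : (typedSupport S N μ ν π).Nonempty)
    (Φs : Finset ((Fin N → I) × (Fin N → J) × (Fin N → L))) (hΦs : Φs ⊆ typedSupport S N μ ν π) :
    ∃ (X' : Finset (Fin N → I)) (Y' : Finset (Fin N → J)) (Z' : Finset (Fin N → L)),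
      (∀ φ ∈ typedSupport S N μ ν π, ∀ ψ ∈ typedSupport S N μ ν π,
        (φ.1 ∈ X' ∧ φ.2.1 ∈ Y' ∧ φ.2.2 ∈ Z') → (ψ.1 ∈ X' ∧ ψ.2.1 ∈ Y' ∧ ψ.2.2 ∈ Z') →
        φ.1 = ψ.1 → φ = ψ) ∧
      (∀ φ ∈ typedSupport S N μ ν π, (φ.1 ∈ X' ∧ φ.2.1 ∈ Y' ∧ φ.2.2 ∈ Z') → φ ∈ Φs) ∧
      ∃ f : ℕ, 1 ≤ f ∧ (typedSupport S N μ ν π).card = (typeClass N μ).card * f ∧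
        Φs.card * rothNumberNat (3 * max f b) ≤
          173 * max f b ^ 2 * (Φs.filter fun φ => φ.1 ∈ X' ∧ φ.2.1 ∈ Y' ∧ φ.2.2 ∈ Z').card := by
  classical
  obtain ⟨φ₀, hφ₀⟩ := hne
  obtain ⟨hμ₀, -, -, -⟩ := mem_typedSupport.1 hφ₀
  -- the typed support, made opaque
  obtain ⟨Φ, hΦ⟩ : ∃ Φ : Finset ((Fin N → I) × (Fin N → J) × (Fin N → L)),
      Φ = typedSupport S N μ ν π := ⟨_, rfl⟩
  rw [← hΦ] at hφ₀ hΦs ⊢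
  -- the tightness maps on words: concatenate the vectors of the letters
  let αN : (Fin N → I) → Fin (N * r) → ℤ := fun x t =>
    α (x (finProdFinEquiv.symm t).1) (finProdFinEquiv.symm t).2
  let βN : (Fin N → J) → Fin (N * r) → ℤ := fun y t =>
    β (y (finProdFinEquiv.symm t).1) (finProdFinEquiv.symm t).2
  let γN : (Fin N → L) → Fin (N * r) → ℤ := fun z t =>
    γ (z (finProdFinEquiv.symm t).1) (finProdFinEquiv.symm t).2
  have hαN : Function.Injective αN := wordVec_injective α hα
  have hβN : Function.Injective βN := wordVec_injective β hβ
  have hγN : Function.Injective γN := wordVec_injective γ hγ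
  have hαNb : ∀ x t, |αN x t| ≤ b := fun x t => hαb _ _
  have hβNb : ∀ y t, |βN y t| ≤ b := fun y t => hβb _ _
  have htightN : ∀ φ ∈ Φ, ∀ t, αN φ.1 t + βN φ.2.1 t + γN φ.2.2 t = 0 := by
    intro φ hφ t
    rw [hΦ] at hφ
    exact htight _ ((mem_typedSupport.1 hφ).2.2.2 _) _
  -- THE `X`-fibre size `f`
  set f := (Φ.filter fun φ => φ.1 = φ₀.1).card with hf
  have hf1 : 1 ≤ f := Finset.card_pos.2 ⟨φ₀, Finset.mem_filter.2 ⟨hφ₀, rfl⟩⟩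
  have hfI : ∀ x, (Φ.filter fun φ => φ.1 = x).card ≤ f := fun x => by
    have h := card_fibre₁_le S μ ν π hμ₀ x
    rw [← hΦ] at h
    rwa [hf]
  have hΦf : Φ.card = (typeClass N μ).card * f := by
    rw [hf, hΦ]; exact card_typedSupport_eq_mul_fibre₁ S μ ν π hμ₀
  -- a Bertrand prime `6 f' < M ≤ 12 f'`, `f' = max f b`
  set f' := max f b with hf'
  have hff' : f ≤ f' := le_max_left _ _
  have hbf' : b ≤ f' := le_max_right _ _
  have hf'1 : 1 ≤ f' := le_trans hf1 hff'
  obtain ⟨M, hMp, hM1, hM2⟩ := Nat.exists_prime_lt_and_le_two_mul (6 * f') (by omega)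
  haveI : NeZero M := ⟨hMp.ne_zero⟩
  have hbM : 2 * b < M := by omega
  have hM3 : 2 * (M / 2) ≤ M := Nat.mul_div_le M 2
  have hfM : 3 * f' ≤ M / 2 := by omega
  have hM12 : M ≤ 12 * f' := by omega
  -- the Salem–Spencer diagonal with `k = M / 2` and Lemma 5.5
  obtain ⟨D₁, D₂, D₃, hD₁, hD₂, hD₃, hDcard⟩ := exists_zeroSum_diagonal M (M / 2) hM3
  obtain ⟨X', Y', Z', huniq, hmem, hsize⟩ := advxxz2025_lemma55 Φ αN βN γN hαN hβN hγN hαNb hβNb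
    htightN Φs hΦs hfI hMp hbM D₁ D₂ D₃ hD₁ hD₂ hD₃
  refine ⟨X', Y', Z', huniq, hmem, f, hf1, hΦf, ?_⟩
  -- the size bound, from `|Φ*| |D| (M - f) ≤ M³ |Ψ*|` with `6f' < M ≤ 12 f'`
  obtain ⟨D, hD⟩ : ∃ D : Finset (ZMod M × ZMod M × ZMod M),
      D = (D₁ ×ˢ D₂ ×ˢ D₃).filter fun d => d.1 + d.2.1 + d.2.2 = 0 := ⟨_, rfl⟩
  rw [← hD] at hsize hDcard
  set Ψs := Φs.filter fun φ => φ.1 ∈ X' ∧ φ.2.1 ∈ Y' ∧ φ.2.2 ∈ Z' with hΨs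
  have hroth : rothNumberNat (3 * f') ≤ D.card := (rothNumberNat.mono hfM).trans hDcard
  have hM0 : (0 : ℤ) < M := by exact_mod_cast hMp.pos
  have hΦD : (0 : ℤ) ≤ (Φs.card : ℤ) * D.card := mul_nonneg (Nat.cast_nonneg _) (Nat.cast_nonneg _)
  have hM6 : (6 * f : ℤ) < M := by exact_mod_cast (show 6 * f < M by omega)
  have h1 : 5 * ((Φs.card : ℤ) * D.card * M) ≤ 6 * (M : ℤ) ^ 3 * Ψs.card :=
    calc 5 * ((Φs.card : ℤ) * D.card * M) = (Φs.card : ℤ) * D.card * (5 * (M : ℤ)) := by ring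
      _ ≤ (Φs.card : ℤ) * D.card * (6 * ((M : ℤ) - f)) :=
          mul_le_mul_of_nonneg_left (by linarith only [hM6]) hΦD
      _ = 6 * ((Φs.card : ℤ) * D.card * ((M : ℤ) - f)) := by ring
      _ ≤ 6 * ((M : ℤ) ^ 3 * Ψs.card) := mul_le_mul_of_nonneg_left hsize (by norm_num)
      _ = 6 * (M : ℤ) ^ 3 * Ψs.card := by ring
  have h2 : 5 * ((Φs.card : ℤ) * D.card) ≤ 6 * (M : ℤ) ^ 2 * Ψs.card := by
    refine le_of_mul_le_mul_right ?_ hM0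
    calc 5 * ((Φs.card : ℤ) * D.card) * M = 5 * ((Φs.card : ℤ) * D.card * M) := by ring
      _ ≤ 6 * (M : ℤ) ^ 3 * Ψs.card := h1
      _ = 6 * (M : ℤ) ^ 2 * Ψs.card * M := by ring
  have hMsq : (M : ℤ) ^ 2 ≤ (12 * f' : ℤ) ^ 2 :=
    pow_le_pow_left₀ hM0.le (by exact_mod_cast hM12) 2
  have h3 : 5 * ((Φs.card : ℤ) * rothNumberNat (3 * f')) ≤ 864 * (f' : ℤ) ^ 2 * Ψs.card :=
    calc 5 * ((Φs.card : ℤ) * rothNumberNat (3 * f')) ≤ 5 * ((Φs.card : ℤ) * D.card) :=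
          mul_le_mul_of_nonneg_left
            (mul_le_mul_of_nonneg_left (by exact_mod_cast hroth) (Nat.cast_nonneg _)) (by norm_num)
      _ ≤ 6 * (M : ℤ) ^ 2 * Ψs.card := h2
      _ ≤ 6 * (12 * (f' : ℤ)) ^ 2 * Ψs.card :=
          mul_le_mul_of_nonneg_right (mul_le_mul_of_nonneg_left hMsq (by norm_num))
            (Nat.cast_nonneg _)
      _ = 864 * (f' : ℤ) ^ 2 * Ψs.card := by ring
  have h4 : ((Φs.card * rothNumberNat (3 * f') : ℕ) : ℤ) ≤ ((173 * f' ^ 2 * Ψs.card : ℕ) : ℤ) := by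
    push_cast
    have hΨ0 : (0 : ℤ) ≤ (f' : ℤ) ^ 2 * Ψs.card := by positivity
    linarith
  exact_mod_cast h4

end Typed

end Literature.Computability.AlgebraicComplexity
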